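import Mathlib
import Summits.ResolutionOfSingularities.ResolutionOfSingularities.Theorems.WeightedInvariantLocalWeightedDropTOT2CurveBranchWitnessInsepTools

/-!
# `LocalWeightedDrop`, TOT2-LINE regime (P), piece (β-prime) — KEY: an irreducible power series over a perfect field of characteristic `p`
# does not divide all its partial derivatives

Crux item stmt-ResolutionOfSingularities-8899 `WeightedInvariant.LocalWeightedDrop` (route `ResolutionOfSingularities/WeightedInvariant`), ENGINE
skeleton v33 (35b29332b4d99231), registered stub `stub_regimePresented`, piece (P3) (res-type-088's conflict budget: the index set of top-locus
branches «in prime form», NAMING res-type-088 2026-08-27T16:46:34Z (4), queue order res-L1-w43-plan-1 16:59:11Z (2)).  [OURS · L1 W4.3 · chain w43 ·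
seat res-L1-w43-stub-1 gen 6; def-free; elementary power-series algebra in characteristic `p` with the tree's partial derivatives
`MvPowerSeries.pderiv` (Literature `PowerSeriesRegularLocal`) and `TOT2Curve.exists_pow_eq_of_dvd` (…TOT2CurveBranchWitnessInsepTools); nothing here is a
statement of any manuscript; AI-produced, gate-checked, weaker than expert review.]

THE STATEMENT (`not_forall_dvd_pderiv`).  `k` perfect of characteristic `p`, `σ` finite, `g ∈ k⟦X_σ⟧` irreducible.  Then `g ∤ ∂g/∂Xᵢ` for
some `i`.  (Used in `…NCBranchPrimesFinite`: a prime `g` dividing a squarefree `b` and all `∂ᵢb` would divide all `∂ᵢg`.)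

THE PROOF.  If `g ∣ ∂ᵢg` for all `i`, the ideal `(g)` is stable under the Euler operators `Eᵢ = Xᵢ∂ᵢ` and their translates `Eᵢ − a`
(`dvd_X_mul_pderiv_sub`), which act diagonally on monomials: `(Eᵢ − a)(X^m) = (mᵢ − a)X^m` (`coeff_X_mul_pderiv`).  Hence `(g)` contains, for every
exponent class `α ∈ [0,p)^σ`, the series `Π_{i} Π_{a<p, a≠αᵢ} (Eᵢ − a) · g` (`dvd_of_coeff_eq_prod_mul`), which is a NON-ZERO constant multiple of the
class part `g_α` of `g` (monomials with `m ≡ α (mod p)`; `prod_cast_sub_eq_zero` / `prod_cast_sub_ne_zero` — in characteristic `p`, `(mᵢ : k)` only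
depends on `mᵢ mod p`).  So `g ∣ g_α` for every `α`; as `Σ_α g_α = g` and `k⟦X⟧` is local, `g` is a unit multiple of one class part
(`exists_isUnit_classPart`).  If that class `α` has some `αᵢ ≠ 0` then `Xᵢ ∣ g`, so `g ~ Xᵢ`, but `Xᵢ ∤ ∂ᵢ(vXᵢ) = v + Xᵢ∂ᵢv` for a unit `v`;
if `α = 0` then `g ~ G^p` (`exists_pow_eq_of_dvd`, `k` perfect), which is not irreducible.
-/

set_option linter.dupNamespace false -- mandated namespace of this single-conjunct summit

noncomputable section

namespace Summit.ResolutionOfSingularities.ResolutionOfSingularities.Theorems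

namespace NCBranchPrimes

open MvPowerSeries Literature.AlgebraicGeometry.Resolution

variable {k : Type} [Field k] {σ : Type}

/-! ## The Euler operators act diagonally -/

/-- `Xᵢ ∂ᵢ` multiplies the coefficient of `X^m` by `mᵢ`. -/
theorem coeff_X_mul_pderiv (i : σ) (f : MvPowerSeries σ k) (m : σ →₀ ℕ) :
    coeff m (X i * MvPowerSeries.pderiv i f) = (m i : k) * coeff m f := by
  rw [MvPowerSeries.X_mul_pderiv, MvPowerSeries.coeff_eulerDerivation]

/-- STABILITY.  If `g` divides all its partials, `(g)` is stable under every `Xᵢ∂ᵢ − a`. -/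
theorem dvd_X_mul_pderiv_sub {g : MvPowerSeries σ k} (hg : ∀ i, g ∣ MvPowerSeries.pderiv i g) {f : MvPowerSeries σ k} (hf : g ∣ f)
    (i : σ) (a : k) : g ∣ X i * MvPowerSeries.pderiv i f - C a * f := by
  obtain ⟨h, rfl⟩ := hf
  obtain ⟨r, hr⟩ := hg i
  refine ⟨X i * (MvPowerSeries.pderiv i h + h * r) - C a * h, ?_⟩
  rw [Derivation.leibniz, smul_eq_mul, smul_eq_mul, hr]
  ring

/-! ## The Lagrange factors -/

/-- In characteristic `p`, `Π_{a<p, a ≠ t} ((n : k) − a) = 0` when `n mod p ≠ t`: the factor `a = n mod p` vanishes. -/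
theorem prod_cast_sub_eq_zero (p : ℕ) [Fact p.Prime] [CharP k p] {n t : ℕ} (hnt : n % p ≠ t) :
    ∏ a ∈ (Finset.range p).filter (fun a => a ≠ t), ((n : k) - (a : k)) = 0 := by
  have hp : p.Prime := Fact.out
  apply Finset.prod_eq_zero (i := n % p)
  · rw [Finset.mem_filter, Finset.mem_range]
    exact ⟨Nat.mod_lt _ hp.pos, hnt⟩
  · rw [CharP.cast_eq_mod k p n, sub_self]

/-- In characteristic `p`, `(s : k) ≠ (a : k)` for `s ≠ a` both `< p`. -/
theorem cast_sub_cast_ne_zero (p : ℕ) [Fact p.Prime] [CharP k p] {s a : ℕ} (hs : s < p) (ha : a < p) (hsa : a ≠ s) :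
    (s : k) - (a : k) ≠ 0 := by
  intro h0
  rw [sub_eq_zero] at h0
  have h1 := (CharP.natCast_eq_natCast k p).mp h0
  rw [Nat.ModEq, Nat.mod_eq_of_lt hs, Nat.mod_eq_of_lt ha] at h1
  exact hsa h1.symm

/-- In characteristic `p`, `Π_{a<p, a ≠ t} ((n : k) − a) ≠ 0` when `n mod p = t`. -/
theorem prod_cast_sub_ne_zero (p : ℕ) [Fact p.Prime] [CharP k p] {n t : ℕ} (hnt : n % p = t) :
    ∏ a ∈ (Finset.range p).filter (fun a => a ≠ t), ((n : k) - (a : k)) ≠ 0 := by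
  have hp : p.Prime := Fact.out
  rw [Finset.prod_ne_zero_iff]
  intro a ha
  rw [Finset.mem_filter, Finset.mem_range] at ha
  rw [CharP.cast_eq_mod k p n, hnt]
  exact cast_sub_cast_ne_zero p (hnt ▸ Nat.mod_lt _ hp.pos) ha.1 ha.2

/-- The Lagrange factor of a class `α` at an exponent `m`: zero off the class. -/
theorem prod_prod_cast_sub_eq_zero [Fintype σ] (p : ℕ) [Fact p.Prime] [CharP k p] (α : σ → ℕ) {m : σ →₀ ℕ} (hm : ¬ ∀ i, m i % p = α i) :
    ∏ i, ∏ a ∈ (Finset.range p).filter (fun a => a ≠ α i), ((m i : k) - (a : k)) = 0 := by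
  push Not at hm
  obtain ⟨i, hi⟩ := hm
  exact Finset.prod_eq_zero (Finset.mem_univ i) (prod_cast_sub_eq_zero p hi)

/-- The Lagrange factor of a class `α` at an exponent `m`: non-zero on the class. -/
theorem prod_prod_cast_sub_ne_zero [Fintype σ] (p : ℕ) [Fact p.Prime] [CharP k p] (α : σ → ℕ) {m : σ →₀ ℕ} (hm : ∀ i, m i % p = α i) :
    ∏ i, ∏ a ∈ (Finset.range p).filter (fun a => a ≠ α i), ((m i : k) - (a : k)) ≠ 0 :=
  Finset.prod_ne_zero_iff.mpr fun i _ => prod_cast_sub_ne_zero p (hm i)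

/-! ## `(g)` contains the class parts of `g` -/

/-- ITERATED STABILITY along one letter: `(g)` contains the series with coefficients `(Π_{a ∈ S} (mᵢ − a)) · Λ(m) · coeff_m g` whenever it
contains the one with coefficients `Λ(m) · coeff_m g`. -/
theorem dvd_of_coeff_eq_prod_mul {g : MvPowerSeries σ k} (hg : ∀ i, g ∣ MvPowerSeries.pderiv i g) (i : σ) (Λ : (σ →₀ ℕ) → k)
    (S : Finset ℕ) : ∀ F : MvPowerSeries σ k, (∀ m, coeff m F = (∏ a ∈ S, ((m i : k) - (a : k))) * (Λ m * coeff m g)) →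
      (∀ F₀ : MvPowerSeries σ k, (∀ m, coeff m F₀ = Λ m * coeff m g) → g ∣ F₀) → g ∣ F := by
  classical
  induction S using Finset.induction_on with
  | empty =>
    intro F hF hF₀
    exact hF₀ F fun m => by rw [hF, Finset.prod_empty, one_mul]
  | insert a S haS ih =>
    intro F hF hF₀
    -- the series one step before
    obtain ⟨F₁, hF₁⟩ : ∃ F₁ : MvPowerSeries σ k, ∀ m, coeff m F₁ = (∏ a ∈ S, ((m i : k) - (a : k))) * (Λ m * coeff m g) :=
      ⟨show MvPowerSeries σ k from fun m => (∏ a ∈ S, ((m i : k) - (a : k))) * (Λ m * coeff m g), fun m => rfl⟩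
    have h1 : g ∣ F₁ := ih F₁ hF₁ hF₀
    have h2 : F = X i * MvPowerSeries.pderiv i F₁ - C (a : k) * F₁ := by
      ext m
      rw [hF, Finset.prod_insert haS, map_sub, coeff_X_mul_pderiv, coeff_C_mul, hF₁]
      ring
    rw [h2]
    exact dvd_X_mul_pderiv_sub hg h1 i (a : k)

/-- ITERATED STABILITY over a set of letters: `(g)` contains the series with coefficients `(Π_{i ∈ T} Π_{a<p, a≠αᵢ} (mᵢ − a)) · coeff_m g`. -/
theorem dvd_of_coeff_eq_prod_prod (p : ℕ) {g : MvPowerSeries σ k} (hg : ∀ i, g ∣ MvPowerSeries.pderiv i g) (α : σ → ℕ) (T : Finset σ) :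
    ∀ F : MvPowerSeries σ k,
      (∀ m, coeff m F = (∏ i ∈ T, ∏ a ∈ (Finset.range p).filter (fun a => a ≠ α i), ((m i : k) - (a : k))) * coeff m g) → g ∣ F := by
  classical
  induction T using Finset.induction_on with
  | empty =>
    intro F hF
    have h1 : F = g := by
      ext m
      rw [hF, Finset.prod_empty, one_mul]
    rw [h1]
  | insert i T hiT ih =>
    intro F hF
    refine dvd_of_coeff_eq_prod_mul hg i
      (fun m => ∏ j ∈ T, ∏ a ∈ (Finset.range p).filter (fun a => a ≠ α j), ((m j : k) - (a : k)))
      ((Finset.range p).filter (fun a => a ≠ α i)) F (fun m => by rw [hF, Finset.prod_insert hiT, mul_assoc]) ?_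
    intro F₀ hF₀
    exact ih F₀ hF₀

/-- **`g ∣ g_α`**: if `g` divides all its partials, it divides each of its exponent-class parts `g_α` (monomials with `m ≡ α (mod p)`;
given by its coefficients `hP`). -/
theorem dvd_classPart [Fintype σ] (p : ℕ) [Fact p.Prime] [CharP k p] {g : MvPowerSeries σ k} (hg : ∀ i, g ∣ MvPowerSeries.pderiv i g) (α : σ → ℕ)
    (P : MvPowerSeries σ k) (hP : ∀ m, coeff m P = if (∀ i, m i % p = α i) then coeff m g else 0) : g ∣ P := by
  classical
  have hp : p.Prime := Fact.out
  by_cases hα : ∀ i, α i < p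
  swap
  · -- an empty class
    push Not at hα
    obtain ⟨i, hi⟩ := hα
    have hP0 : P = 0 := by
      ext m
      rw [hP, map_zero, if_neg]
      intro hm
      exact absurd ((hm i) ▸ Nat.mod_lt (m i) hp.pos) (not_lt.mpr hi)
    rw [hP0]
    exact dvd_zero g
  -- the Lagrange multiple of `P` lies in `(g)`
  obtain ⟨F, hF⟩ : ∃ F : MvPowerSeries σ k,
      ∀ m, coeff m F = (∏ i, ∏ a ∈ (Finset.range p).filter (fun a => a ≠ α i), ((m i : k) - (a : k))) * coeff m g :=
    ⟨show MvPowerSeries σ k from fun m => (∏ i, ∏ a ∈ (Finset.range p).filter (fun a => a ≠ α i), ((m i : k) - (a : k))) * coeff m g,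
      fun m => rfl⟩
  have hgF : g ∣ F := dvd_of_coeff_eq_prod_prod p hg α Finset.univ F hF
  -- `F = c • P` with the non-zero constant `c = Π_i Π_{a ≠ αᵢ} (αᵢ − a)`
  set c : k := ∏ i, ∏ a ∈ (Finset.range p).filter (fun a => a ≠ α i), ((α i : k) - (a : k)) with hc
  have hc0 : c ≠ 0 := by
    rw [hc, Finset.prod_ne_zero_iff]
    intro i _
    exact prod_cast_sub_ne_zero (k := k) p (n := α i) (t := α i) (Nat.mod_eq_of_lt (hα i))
  have hFP : F = C c * P := by
    ext m
    rw [hF, coeff_C_mul, hP]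
    split_ifs with hm
    · congr 1
      rw [hc]
      refine Finset.prod_congr rfl fun i _ => Finset.prod_congr rfl fun a _ => ?_
      rw [CharP.cast_eq_mod k p (m i), hm i]
    · rw [mul_zero, prod_prod_cast_sub_eq_zero (k := k) p α hm, zero_mul]
  rw [hFP] at hgF
  have h1 : P = C c⁻¹ * (C c * P) := by
    rw [← mul_assoc, ← map_mul, inv_mul_cancel₀ hc0, map_one, one_mul]
  rw [h1]
  exact Dvd.dvd.mul_left hgF _

/-! ## The class parts sum to `g`; one of them is a unit multiple of `g` -/

/-- The class parts of `g` (classes `α ∈ [0,p)^σ`) sum to `g`. -/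
theorem sum_classPart_eq [Fintype σ] [DecidableEq σ] (p : ℕ) [Fact p.Prime] (g : MvPowerSeries σ k) (P : (σ → ℕ) → MvPowerSeries σ k)
    (hP : ∀ α m, coeff m (P α) = if (∀ i, m i % p = α i) then coeff m g else 0) :
    ∑ α ∈ Fintype.piFinset (fun _ : σ => Finset.range p), P α = g := by
  classical
  have hp : p.Prime := Fact.out
  ext m
  rw [map_sum, Finset.sum_eq_single (fun i => m i % p)]
  · rw [hP, if_pos (fun i => rfl)]
  · intro α _ hne
    rw [hP, if_neg]
    intro h
    exact hne (funext fun i => (h i).symm)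
  · intro h
    exact absurd (Fintype.mem_piFinset.mpr fun i => Finset.mem_range.mpr (Nat.mod_lt _ hp.pos)) h

/-- If `g ≠ 0` divides all its partials, then `g` divides every class part and ONE class part is a unit multiple of `g` (`k⟦X⟧` is local). -/
theorem exists_isUnit_classPart [Fintype σ] [DecidableEq σ] (p : ℕ) [Fact p.Prime] [CharP k p] {g : MvPowerSeries σ k} (hg0 : g ≠ 0)
    (hg : ∀ i, g ∣ MvPowerSeries.pderiv i g) (P : (σ → ℕ) → MvPowerSeries σ k)
    (hP : ∀ α m, coeff m (P α) = if (∀ i, m i % p = α i) then coeff m g else 0) :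
    ∃ (α : σ → ℕ) (u : MvPowerSeries σ k), IsUnit u ∧ P α = g * u := by
  classical
  choose h hh using fun α => dvd_classPart p hg α (P α) (hP α)
  have hsum : ∑ α ∈ Fintype.piFinset (fun _ : σ => Finset.range p), h α = 1 := by
    have h1 := sum_classPart_eq p g P hP
    simp only [hh, ← Finset.mul_sum] at h1
    exact mul_left_cancel₀ hg0 (h1.trans (mul_one g).symm)
  by_contra hne
  push Not at hne
  have hmem : ∀ α ∈ Fintype.piFinset (fun _ : σ => Finset.range p), h α ∈ IsLocalRing.maximalIdeal (MvPowerSeries σ k) := by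
    intro α _
    rw [IsLocalRing.mem_maximalIdeal, mem_nonunits_iff]
    intro hu
    exact hne α (h α) hu (hh α)
  have h1 : (1 : MvPowerSeries σ k) ∈ IsLocalRing.maximalIdeal (MvPowerSeries σ k) := by
    rw [← hsum]
    exact Ideal.sum_mem _ hmem
  exact (IsLocalRing.maximalIdeal.isMaximal (MvPowerSeries σ k)).ne_top ((Ideal.eq_top_iff_one _).mpr h1)

/-! ## The key -/

/-- `Xᵢ` does not divide `Xᵢ·w + v` for a unit `v`. -/
theorem not_X_dvd_add_of_isUnit (i : σ) {v : MvPowerSeries σ k} (hv : IsUnit v) (w : MvPowerSeries σ k) : ¬ X i ∣ X i * w + v := by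
  intro h
  have h1 : X i ∣ v := (dvd_add_right (dvd_mul_right (X i) w)).mp h
  have h2 := (X_dvd_iff.mp h1) 0 (Finsupp.zero_apply)
  rw [coeff_zero_eq_constantCoeff] at h2
  exact (MvPowerSeries.isUnit_iff_constantCoeff.mp hv).ne_zero h2

/-- **(KEY-p) AN IRREDUCIBLE POWER SERIES OVER A PERFECT FIELD OF CHARACTERISTIC `p` DOES NOT DIVIDE ALL ITS PARTIAL DERIVATIVES.** -/
theorem not_forall_dvd_pderiv [Fintype σ] (p : ℕ) [Fact p.Prime] [CharP k p] [PerfectRing k p] {g : MvPowerSeries σ k} (hirr : Irreducible g) :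
    ¬ ∀ i, g ∣ MvPowerSeries.pderiv i g := by
  classical
  have hp : p.Prime := Fact.out
  intro hg
  -- the class parts of `g`
  obtain ⟨P, hP⟩ : ∃ P : (σ → ℕ) → MvPowerSeries σ k, ∀ α m, coeff m (P α) = if (∀ i, m i % p = α i) then coeff m g else 0 :=
    ⟨fun α => show MvPowerSeries σ k from fun m => if (∀ i, m i % p = α i) then coeff m g else 0, fun α m => rfl⟩
  obtain ⟨α, u, hu, hα⟩ := exists_isUnit_classPart p hirr.ne_zero hg P hP
  by_cases hA : ∃ i, α i ≠ 0
  · -- `Xᵢ ∣ g`, so `g ~ Xᵢ`, but `Xᵢ ∤ ∂ᵢ(Xᵢ r) = r + Xᵢ ∂ᵢ r`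
    obtain ⟨i, hi⟩ := hA
    have hXP : X i ∣ P α := by
      rw [X_dvd_iff]
      intro m hm
      rw [hP, if_neg]
      intro h
      have h1 := h i
      rw [hm, Nat.zero_mod] at h1
      exact hi h1.symm
    rw [hα] at hXP
    obtain ⟨r, hr⟩ := (hu.dvd_mul_right.mp hXP)
    have hru : IsUnit r := by
      rcases hirr.isUnit_or_isUnit hr with hX | hr'
      · exact absurd hX (fun hX => by
          have h1 := MvPowerSeries.isUnit_iff_constantCoeff.mp hX
          rw [constantCoeff_X] at h1
          exact not_isUnit_zero h1)
      · exact hr'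
    have h1 := hg i
    rw [hr, Derivation.leibniz, smul_eq_mul, smul_eq_mul, MvPowerSeries.pderiv_X, if_pos rfl, mul_one] at h1
    exact not_X_dvd_add_of_isUnit i hru (MvPowerSeries.pderiv i r) ((dvd_mul_right (X i) r).trans h1)
  · -- all classes zero: `g ~ G^p`, not irreducible
    push Not at hA
    obtain ⟨G, hG, -⟩ := TOT2Curve.exists_pow_eq_of_dvd p (P α) (fun e he i => by
      rw [hP] at he
      split_ifs at he with h
      · have h1 := h i
        rw [hA i] at h1
        exact Nat.dvd_of_mod_eq_zero h1
      · exact absurd rfl he)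
    rw [hα] at hG
    have hirr' : Irreducible (G ^ p) := by
      rw [hG]
      exact (irreducible_mul_isUnit hu).mpr hirr
    have hsplit : G ^ p = G * G ^ (p - 1) := by
      rw [← pow_succ', Nat.sub_add_cancel hp.one_lt.le]
    have hGu : ¬ IsUnit G := fun hGu => hirr'.not_isUnit (hGu.pow p)
    rcases hirr'.isUnit_or_isUnit hsplit with h1 | h1
    · exact hGu h1
    · exact hGu ((isUnit_pow_iff (Nat.sub_ne_zero_of_lt hp.one_lt)).mp h1)

end NCBranchPrimes

end Summit.ResolutionOfSingularities.ResolutionOfSingularities.Theorems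

end
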